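import Literature.Geometry.Lorentzian.KerrDeSitterData
import HarnessLib

/-!
# The Kerr–de Sitter star-chart metric is Lorentzian (discharge of `KerrDeSitter.isLorentzian_bilin`)

Family `gr`; follows `KerrDeSitter.lean` / `KerrDeSitterData.lean` (definition request
`defn-KerrDeSitterData`; the review of p53985 asked for this discharge).

We prove the named fact `KerrDeSitter.isLorentzian_bilin M a Λ r₀` (a field of
`KerrDeSitter.Facts`): for regular parameters the explicit bilinear form `KerrDeSitter.bilin M a Λ x`
is nondegenerate, has a timelike vector, and is positive definite on the orthogonal complement of
every timelike vector, at every point of `Kerr.region a r₀`. The proof is the one indicated in the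
docstring of the fact, organised as follows.

* `KerrDeSitter.bilin_spatial_pos`: the form is **positive definite on the spatial vectors**
  `w = (0, w⃗)` (equivalently on `T^⊥`, since `g(T, w) = −w⁰`, `bilin_timeVector_holds`): off the
  axis, completing squares in the induced metric of the slice,
  `g(w, w) = (ρ²/(Δ_θ r² sin²θ)) (z dr(w)/r − w³)² + ρ²q̂ (dr(w) + c σ(w))² + P σ(w)²` with
  `P · ρ²q̂ = [q̂ Δ_θ (r²+a²)² − a² sin²θ (q̂Δ_r + f²)]/(Ξ² sin²θ (r²+a²)²) > 0` exactly when
  `Q > Ξ²a² sin²θ/Δ_θ` (Petersen–Vasy arXiv:2112.01355, Remark 1.1, (1.9), here via `IsRegular`);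
  on the axis `g(w, w) = (w₁² + w₂²)/Δ_θ + q̂(r²+a²)² z² w₃²/(r²ρ²) + …`;
* `pos_of_orthogonal_of_pos_on_orthogonal`: the linear-algebra lemma that a symmetric bilinear
  form with a vector `T`, `g(T, T) < 0`, which is positive definite on `T^⊥`, is positive definite on
  the orthogonal complement of *every* timelike vector (O'Neill 1983, Ch. 5, Lemma 5.26; Sylvester);
* `KerrDeSitter.isLorentzian_bilin_holds`: nondegeneracy (`g(v, ·) = 0` forces `v⁰ = −g(T, v) = 0`
  and then `g(v, v) = 0` forces `v = 0`), the timelike vector `T` (`g(T, T) = −T⁰ < 0`), and the lemma.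

## References

* B. O'Neill, *Semi-Riemannian geometry* (1983), Ch. 5, Lemma 5.26 (timecones; the orthogonal
  complement of a timelike vector is spacelike).
* O. Petersen, A. Vasy, arXiv:2112.01355, Remark 1.1 (the spacelike condition (1.9)).
* P. Hintz, A. Vasy, Acta Math. 220 (2018), §3.2 (non-degeneracy of `g_b`, incl. the poles).
-/

noncomputable section

open Bundle TopologicalSpace

namespace Literature.Geometry.Lorentzian

/-! ### A symmetric form negative on `T` and positive on `T^⊥` has index one -/

/-- **Index-one criterion.** Let `g` be a symmetric bilinear form on a real vector space, `T` a
vector with `g(T, T) < 0` such that `g` is positive definite on `T^⊥ = {w | g(T, w) = 0}`. Then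
for every `v` with `g(v, v) < 0` and every `w ≠ 0` with `g(v, w) = 0` one has `g(w, w) > 0` (write
`v = αT + v'`, `w = βT + w'` with `v', w' ∈ T^⊥` and use the Cauchy–Schwarz inequality of `g|_{T^⊥}`).
O'Neill 1983, Ch. 5, Lemma 5.26 (and the basis-independence of the index, Sylvester's law). [cite: ONeill1983, Ch. 5 Lemma 5.26] -/
theorem pos_of_orthogonal_of_pos_on_orthogonal {V : Type*} [AddCommGroup V] [Module ℝ V]
    [TopologicalSpace V] (g : V →L[ℝ] V →L[ℝ] ℝ) (hsymm : ∀ v w, g v w = g w v) (T : V)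
    (hT : g T T < 0) (hpos : ∀ w, g T w = 0 → w ≠ 0 → 0 < g w w) (v w : V) (hv : g v v < 0)
    (hvw : g v w = 0) (hw : w ≠ 0) : 0 < g w w := by
  -- decomposition along `T`
  set τ : ℝ := g T T with hτ
  set α : ℝ := g T v / τ with hα
  set β : ℝ := g T w / τ with hβ
  set v' : V := v - α • T with hv'
  set w' : V := w - β • T with hw'
  have hτ0 : τ ≠ 0 := hT.ne
  have hTv' : g T v' = 0 := by
    simp only [hv', map_sub, map_smul, smul_eq_mul, hα]
    field_simp
    ring
  have hTw' : g T w' = 0 := by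
    simp only [hw', map_sub, map_smul, smul_eq_mul, hβ]
    field_simp
    ring
  have hv'T : g v' T = 0 := by rw [hsymm, hTv']
  have hw'T : g w' T = 0 := by rw [hsymm, hTw']
  have hpos' : ∀ u, g T u = 0 → 0 ≤ g u u := fun u hu ↦ by
    by_cases h0 : u = 0
    · simp [h0]
    · exact (hpos u hu h0).le
  -- the quadratic forms in the decomposition
  have hvdec : v = α • T + v' := by rw [hv']; abel
  have hwdec : w = β • T + w' := by rw [hw']; abel
  have hvv : g v v = α ^ 2 * τ + g v' v' := by
    conv_lhs => rw [hvdec]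
    simp only [map_add, map_smul, add_apply, smul_apply, smul_eq_mul, hTv', hv'T]
    ring
  have hww : g w w = β ^ 2 * τ + g w' w' := by
    conv_lhs => rw [hwdec]
    simp only [map_add, map_smul, add_apply, smul_apply, smul_eq_mul, hTw', hw'T]
    ring
  have hvw' : g v w = α * β * τ + g v' w' := by
    conv_lhs => rw [hvdec, hwdec]
    simp only [map_add, map_smul, add_apply, smul_apply, smul_eq_mul, hTw', hv'T]
    ring
  rw [hvw'] at hvw
  rw [hvv] at hv
  rw [hww]
  have hv'v' : 0 ≤ g v' v' := hpos' v' hTv'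
  -- `α ≠ 0` (else `g v v = g v' v' ≥ 0`)
  have hα0 : α ≠ 0 := by
    intro hα0
    rw [hα0] at hv
    simp only [ne_eq, OfNat.ofNat_ne_zero, not_false_eq_true, zero_pow, zero_mul, zero_add] at hv
    linarith
  -- Cauchy–Schwarz on `T^⊥`: `(g v' w')² ≤ g v' v' · g w' w'`
  have hCS : g v' w' ^ 2 ≤ g v' v' * g w' w' := by
    by_cases hw'0 : g w' w' = 0
    · -- then `w' = 0` or ... : if `w' ≠ 0` positivity gives `g w' w' > 0`; so `w' = 0`
      have : w' = 0 := by
        by_contra hne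
        exact (hpos w' hTw' hne).ne' hw'0
      simp [this]
    · have hw'pos : 0 < g w' w' := lt_of_le_of_ne (hpos' w' hTw') (Ne.symm hw'0)
      -- `0 ≤ g(u, u)` for `u = g(w',w') v' − g(v',w') w' ∈ T^⊥`
      set u : V := g w' w' • v' - g v' w' • w' with hu
      have hTu : g T u = 0 := by
        simp only [hu, map_sub, map_smul, smul_eq_mul, hTv', hTw']; ring
      have huu : g u u = g w' w' * (g v' v' * g w' w' - g v' w' ^ 2) := by
        simp only [hu, map_sub, map_smul, sub_apply, smul_apply, smul_eq_mul, hsymm w' v']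
        ring
      have := hpos' u hTu
      rw [huu] at this
      nlinarith
  -- conclude
  have h1 : g v' v' < -(α ^ 2 * τ) := by linarith
  have h2 : g v' w' = -(α * β * τ) := by linarith
  rw [h2] at hCS
  -- `α²β²τ² ≤ g v'v' · g w'w' < (−α²τ) · g w'w'` unless `g w' w' = 0`
  by_cases hw'0 : w' = 0
  · -- then `β ≠ 0` and `hvw` forces `α β τ = 0`, contradiction with `α, τ ≠ 0`
    have hβ0 : β ≠ 0 := by
      intro hβ0
      apply hw
      rw [hwdec, hw'0, hβ0, zero_smul, add_zero]
    rw [hw'0, map_zero] at h2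
    have h3 : α * β * τ = 0 := by linarith
    exact (mul_ne_zero (mul_ne_zero hα0 hβ0) hτ0 h3).elim
  · have hw'pos : 0 < g w' w' := hpos w' hTw' hw'0
    have hτneg : τ < 0 := hT
    nlinarith [sq_nonneg α, sq_nonneg β, mul_pos (mul_pos (sq_pos_of_ne_zero hα0) (neg_pos.2 hτneg)) hw'pos,
      sq_nonneg (α * β * τ)]

namespace KerrDeSitter

/-! ### Positivity on spatial vectors -/

/-- The **`θ`-part identity** of the flat metric in oblate spheroidal coordinates, in Cartesian
form: off the axis (`sin²θ ≠ 0`),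
`δ(w, w) − (ρ²/(r²+a²)) dr(w)² = ρ² (z dr(w)/r − w³)²/(r² sin²θ) + σ(w)²/((r²+a²) sin²θ)`
(i.e. `δ = ρ² dr²/(r²+a²) + ρ² dθ² + (r²+a²) sin²θ dφ*²` with `ρ dθ = ρ(cos θ dr − dz)/(r sin θ)`).
Uses the quartic of the Kerr–Schild radius. Visser arXiv:0706.0622, §5. [cite: arXiv07060622, §5] -/
theorem spatialDelta_sub_eq (a : ℝ) {x : E4} (hx : 0 < Kerr.radius a x) (hs : sinSq a x ≠ 0)
    (w : E4) :
    E4.spatialDelta w w - rhoSq a x / (Kerr.radius a x ^ 2 + a ^ 2) * drCovector a x w ^ 2 =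
      rhoSq a x * (x 3 / Kerr.radius a x * drCovector a x w - w 3) ^ 2 /
          (Kerr.radius a x ^ 2 * sinSq a x) +
        E4.sigma x w ^ 2 / ((Kerr.radius a x ^ 2 + a ^ 2) * sinSq a x) := by
  have hr : Kerr.radius a x ≠ 0 := hx.ne'
  have hra : Kerr.radius a x ^ 2 + a ^ 2 ≠ 0 := by positivity
  have hρ : rhoSq a x ≠ 0 := (rhoSq_pos a hx).ne'
  have h := sq_add_sq_eq_sinSq a hx
  have h0 : x 1 ^ 2 + x 2 ^ 2 - (Kerr.radius a x ^ 2 + a ^ 2) * sinSq a x = 0 := by linarith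
  have hs' : Kerr.radius a x ^ 2 - x 3 ^ 2 ≠ 0 := by
    have heq : sinSq a x = (Kerr.radius a x ^ 2 - x 3 ^ 2) / Kerr.radius a x ^ 2 := by
      unfold sinSq; field_simp
    intro h0'
    apply hs
    rw [heq, h0', zero_div]
  have key : E4.spatialDelta w w - rhoSq a x / (Kerr.radius a x ^ 2 + a ^ 2) * drCovector a x w ^ 2 =
      rhoSq a x * (x 3 / Kerr.radius a x * drCovector a x w - w 3) ^ 2 /
          (Kerr.radius a x ^ 2 * sinSq a x) +
        E4.sigma x w ^ 2 / ((Kerr.radius a x ^ 2 + a ^ 2) * sinSq a x) -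
        (w 1 ^ 2 + w 2 ^ 2) / ((Kerr.radius a x ^ 2 + a ^ 2) * sinSq a x) *
          (x 1 ^ 2 + x 2 ^ 2 - (Kerr.radius a x ^ 2 + a ^ 2) * sinSq a x) := by
    rw [E4.spatialDelta_apply, Fin.sum_univ_three, drCovector_apply, E4.sigma_apply]
    simp only [Fin.succ_zero_eq_one, Fin.succ_one_eq_two, Fin.reduceSucc]
    unfold rhoSq sinSq at *
    field_simp
    ring
  rw [key, h0, mul_zero, sub_zero]

/-- The Kerr–de Sitter form on a **spatial** vector `w = (0, w⃗)`: `ω(w) = −a σ(w)/(r²+a²)` and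
`g(w, w) = (1/Δ_θ)(δ(w,w) − ρ² dr(w)²/(r²+a²)) + c_σ σ(w)² − (Δ_r a²/(Ξ²ρ²(r²+a²)²)) σ(w)²`
`          + (2fa/(Ξ(r²+a²))) σ(w) dr(w) + ρ² q̂ dr(w)²` — the induced metric of `{t* = const}`
(Petersen–Vasy (1.8) restricted to `dt* = 0`). [cite: PetersenVasy2021, (1.8)] -/
theorem bilin_apply_spatial (M a : ℝ) {Λ : ℝ} (hΛ : 0 ≤ Λ) {x : E4} (hx : 0 < Kerr.radius a x) {w : E4}
    (hw0 : w 0 = 0) :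
    bilin M a Λ x w w =
      (deltaTheta a Λ x)⁻¹ *
          (E4.spatialDelta w w - rhoSq a x / (Kerr.radius a x ^ 2 + a ^ 2) * drCovector a x w ^ 2) +
        sigmaCoeff a Λ x * E4.sigma x w ^ 2 -
        delta M a Λ (Kerr.radius a x) * a ^ 2 / (xi a Λ ^ 2 * rhoSq a x * (Kerr.radius a x ^ 2 + a ^ 2) ^ 2) *
          E4.sigma x w ^ 2 +
        2 * tilt M a Λ (Kerr.radius a x) * a / (xi a Λ * (Kerr.radius a x ^ 2 + a ^ 2)) *
          (E4.sigma x w * drCovector a x w) +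
        rhoSq a x * radialCoeff M a Λ (Kerr.radius a x) * drCovector a x w ^ 2 := by
  have hra : Kerr.radius a x ^ 2 + a ^ 2 ≠ 0 := by positivity
  have hρ : rhoSq a x ≠ 0 := (rhoSq_pos a hx).ne'
  have hΞ : xi a Λ ≠ 0 := (xi_pos hΛ a).ne'
  have hΔ : deltaTheta a Λ x ≠ 0 := (deltaTheta_pos a hΛ x).ne'
  rw [bilin_apply, angularBilin_apply, omegaCovector_apply, hw0, ← E4.sigma_apply]
  field_simp
  ring

/-- `q̂ > 0` on the chart domain for regular parameters (`Ξ² q̂ (r²+a²)² = Q > Ξ²a² ≥ 0`). [folklore] -/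
theorem radialCoeff_pos {M a Λ r₀ : ℝ} (h : IsRegular M a Λ r₀) {x : E4} (hx : x ∈ Kerr.region a r₀) :
    0 < radialCoeff M a Λ (Kerr.radius a x) := by
  have hr0 : 0 < Kerr.radius a x := Kerr.radius_pos_of_mem_region hx
  have hΞ : 0 < xi a Λ := xi_pos h.lambda_nonneg a
  have hra : 0 < Kerr.radius a x ^ 2 + a ^ 2 := by positivity
  have hQ := h.lt_lapseFn hx
  have hq : xi a Λ ^ 2 * radialCoeff M a Λ (Kerr.radius a x) * (Kerr.radius a x ^ 2 + a ^ 2) ^ 2 =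
      lapseFn M a Λ (Kerr.radius a x) := by
    unfold radialCoeff lapseFn
    field_simp
  have hQpos : 0 < lapseFn M a Λ (Kerr.radius a x) := lt_of_le_of_lt (by positivity) hQ
  rw [← hq] at hQpos
  have h1 : 0 < xi a Λ ^ 2 * (Kerr.radius a x ^ 2 + a ^ 2) ^ 2 := by positivity
  nlinarith [hQpos, h1, mul_comm (radialCoeff M a Λ (Kerr.radius a x)) ((Kerr.radius a x ^ 2 + a ^ 2) ^ 2)]
set_option maxHeartbeats 400000 in -- buildfix (bf3-g26): 160k/180k FAIL, 200k PASS at accept time; line-neutral budget line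
/-- **The `t*`-slices are spacelike**: for regular parameters the Kerr–de Sitter form is positive
definite on the spatial vectors `w = (0, w⃗) ≠ 0` at every point of the chart domain. Off the axis
this is the completed-square form of the induced metric with positive determinant
`∝ q̂Δ_θ(r²+a²)² − a² sin²θ` (`Q > Ξ²a² ≥ Ξ²a² sin²θ/Δ_θ`); on the axis it is
`(w₁² + w₂²)/Δ_θ + q̂ (r²+a²)² z² w₃²/(r²ρ²)`. Petersen–Vasy arXiv:2112.01355, Remark 1.1, (1.9). [cite: PetersenVasy2021, Remark 1.1] -/
theorem bilin_spatial_pos {M a Λ r₀ : ℝ} (h : IsRegular M a Λ r₀) {x : E4} (hx : x ∈ Kerr.region a r₀)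
    {w : E4} (hw0 : w 0 = 0) (hw : w ≠ 0) : 0 < bilin M a Λ x w w := by
  have hr0 : 0 < Kerr.radius a x := Kerr.radius_pos_of_mem_region hx
  have hr : Kerr.radius a x ≠ 0 := hr0.ne'
  have hρ : 0 < rhoSq a x := rhoSq_pos a hr0
  have hΞ : 0 < xi a Λ := xi_pos h.lambda_nonneg a
  have hΔθ : 0 < deltaTheta a Λ x := deltaTheta_pos a h.lambda_nonneg x
  have hra : 0 < Kerr.radius a x ^ 2 + a ^ 2 := by positivity
  have hq : 0 < radialCoeff M a Λ (Kerr.radius a x) := radialCoeff_pos h hx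
  have hQ := h.lt_lapseFn hx
  have hR := h.tiltNormSq_pos hx
  have hrel := tilt_sq_add (M := M) h.lambda_nonneg hra.ne' hR
  have hxy := sq_add_sq_eq_sinSq a hr0
  have hρ' : rhoSq a x ≠ 0 := hρ.ne'
  have hra' : Kerr.radius a x ^ 2 + a ^ 2 ≠ 0 := hra.ne'
  have hΞ' : xi a Λ ≠ 0 := hΞ.ne'
  have hΔθ' : deltaTheta a Λ x ≠ 0 := hΔθ.ne'
  have hs1 : sinSq a x ≤ 1 := by
    unfold sinSq
    have : 0 ≤ x 3 ^ 2 / Kerr.radius a x ^ 2 := by positivity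
    linarith
  have hΔθ1 : 1 ≤ deltaTheta a Λ x := by
    unfold deltaTheta
    have : 0 ≤ Λ / 3 * a ^ 2 * x 3 ^ 2 / Kerr.radius a x ^ 2 := by
      have := h.lambda_nonneg; positivity
    linarith
  have hqQ : xi a Λ ^ 2 * radialCoeff M a Λ (Kerr.radius a x) * (Kerr.radius a x ^ 2 + a ^ 2) ^ 2 =
      lapseFn M a Λ (Kerr.radius a x) := by
    unfold radialCoeff lapseFn
    field_simp
  -- `w⃗ ≠ 0`
  have hw123 : w 1 ≠ 0 ∨ w 2 ≠ 0 ∨ w 3 ≠ 0 := by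
    by_contra hall
    simp only [not_or, not_ne_iff] at hall
    apply hw
    ext i
    fin_cases i
    · exact hw0
    · exact hall.1
    · exact hall.2.1
    · exact hall.2.2
  rw [bilin_apply_spatial M a h.lambda_nonneg hr0 hw0]
  by_cases hax : x 1 ^ 2 + x 2 ^ 2 = 0
  · -- on the axis: `x₁ = x₂ = 0`, `sin²θ = 0`, `z² = r²`
    have hx1 : x 1 = 0 := by nlinarith [sq_nonneg (x 1), sq_nonneg (x 2)]
    have hx2 : x 2 = 0 := by nlinarith [sq_nonneg (x 1), sq_nonneg (x 2)]
    have hs0 : sinSq a x = 0 := by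
      rw [hax] at hxy
      rcases mul_eq_zero.1 hxy.symm with h1 | h1
      · exact absurd h1 hra.ne'
      · exact h1
    have hz : x 3 ^ 2 = Kerr.radius a x ^ 2 := by
      unfold sinSq at hs0
      field_simp at hs0
      linarith
    have hz0 : x 3 ≠ 0 := by
      intro h0; rw [h0] at hz; simp at hz; exact hr (by nlinarith [hz])
    have hσ : E4.sigma x w = 0 := by rw [E4.sigma_apply, hx1, hx2]; ring
    have hdr : drCovector a x w = (Kerr.radius a x ^ 2 + a ^ 2) * x 3 / (Kerr.radius a x * rhoSq a x) * w 3 := by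
      rw [drCovector_apply, hx1, hx2]; ring
    have hδ : E4.spatialDelta w w = w 1 ^ 2 + w 2 ^ 2 + w 3 ^ 2 := by
      rw [E4.spatialDelta_apply, Fin.sum_univ_three]
      simp only [Fin.succ_zero_eq_one, Fin.succ_one_eq_two, Fin.reduceSucc]
      ring
    rw [hσ, hdr, hδ]
    have key : (deltaTheta a Λ x)⁻¹ *
          (w 1 ^ 2 + w 2 ^ 2 + w 3 ^ 2 -
            rhoSq a x / (Kerr.radius a x ^ 2 + a ^ 2) *
              ((Kerr.radius a x ^ 2 + a ^ 2) * x 3 / (Kerr.radius a x * rhoSq a x) * w 3) ^ 2) +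
          sigmaCoeff a Λ x * 0 ^ 2 -
          delta M a Λ (Kerr.radius a x) * a ^ 2 /
              (xi a Λ ^ 2 * rhoSq a x * (Kerr.radius a x ^ 2 + a ^ 2) ^ 2) * 0 ^ 2 +
          2 * tilt M a Λ (Kerr.radius a x) * a / (xi a Λ * (Kerr.radius a x ^ 2 + a ^ 2)) *
            (0 * ((Kerr.radius a x ^ 2 + a ^ 2) * x 3 / (Kerr.radius a x * rhoSq a x) * w 3)) +
          rhoSq a x * radialCoeff M a Λ (Kerr.radius a x) *
            ((Kerr.radius a x ^ 2 + a ^ 2) * x 3 / (Kerr.radius a x * rhoSq a x) * w 3) ^ 2 =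
        (deltaTheta a Λ x)⁻¹ * (w 1 ^ 2 + w 2 ^ 2) +
          ((deltaTheta a Λ x)⁻¹ * (1 - (Kerr.radius a x ^ 2 + a ^ 2) * x 3 ^ 2 /
              (Kerr.radius a x ^ 2 * rhoSq a x)) +
            radialCoeff M a Λ (Kerr.radius a x) * (Kerr.radius a x ^ 2 + a ^ 2) ^ 2 * x 3 ^ 2 /
              (Kerr.radius a x ^ 2 * rhoSq a x)) * w 3 ^ 2 := by
      field_simp
      ring
    rw [key]
    -- with `z² = r²`: `ρ² = r² + a²`, the first bracket vanishes
    have hρeq : rhoSq a x = Kerr.radius a x ^ 2 + a ^ 2 := by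
      unfold rhoSq; rw [hz]; field_simp
    rw [hρeq, hz]
    have hvan : 1 - (Kerr.radius a x ^ 2 + a ^ 2) * Kerr.radius a x ^ 2 /
        (Kerr.radius a x ^ 2 * (Kerr.radius a x ^ 2 + a ^ 2)) = 0 := by
      field_simp; ring
    rw [hvan, mul_zero, zero_add]
    have hc : 0 < radialCoeff M a Λ (Kerr.radius a x) * (Kerr.radius a x ^ 2 + a ^ 2) ^ 2 *
        Kerr.radius a x ^ 2 / (Kerr.radius a x ^ 2 * (Kerr.radius a x ^ 2 + a ^ 2)) := by positivity
    have hΔθi : 0 < (deltaTheta a Λ x)⁻¹ := inv_pos.2 hΔθ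
    have t2 : 0 ≤ radialCoeff M a Λ (Kerr.radius a x) * (Kerr.radius a x ^ 2 + a ^ 2) ^ 2 *
        Kerr.radius a x ^ 2 / (Kerr.radius a x ^ 2 * (Kerr.radius a x ^ 2 + a ^ 2)) * w 3 ^ 2 := by
      positivity
    have t1 : 0 ≤ (deltaTheta a Λ x)⁻¹ * (w 1 ^ 2 + w 2 ^ 2) := by positivity
    rcases hw123 with h1 | h2 | h3
    · have t1' : 0 < (deltaTheta a Λ x)⁻¹ * (w 1 ^ 2 + w 2 ^ 2) :=
        mul_pos hΔθi (add_pos_of_pos_of_nonneg (by positivity) (sq_nonneg _))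
      linarith
    · have t1' : 0 < (deltaTheta a Λ x)⁻¹ * (w 1 ^ 2 + w 2 ^ 2) :=
        mul_pos hΔθi (add_pos_of_nonneg_of_pos (sq_nonneg _) (by positivity))
      linarith
    · have t2' : 0 < radialCoeff M a Λ (Kerr.radius a x) * (Kerr.radius a x ^ 2 + a ^ 2) ^ 2 *
          Kerr.radius a x ^ 2 / (Kerr.radius a x ^ 2 * (Kerr.radius a x ^ 2 + a ^ 2)) * w 3 ^ 2 :=
        mul_pos hc (by positivity)
      linarith
  · -- off the axis: `sin²θ > 0`
    have hs : 0 < sinSq a x := by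
      have hpos : 0 < x 1 ^ 2 + x 2 ^ 2 := lt_of_le_of_ne (by positivity) (Ne.symm hax)
      rw [hxy] at hpos
      exact pos_of_mul_pos_right hpos hra.le
    rw [spatialDelta_sub_eq a hr0 hs.ne' w]
    -- completing the square in `(σ, dr)`
    set σ := E4.sigma x w with hσ
    set d := drCovector a x w with hd
    set E := x 3 / Kerr.radius a x * d - w 3 with hE
    have hsq : (deltaTheta a Λ x)⁻¹ *
          (rhoSq a x * E ^ 2 / (Kerr.radius a x ^ 2 * sinSq a x) +
            σ ^ 2 / ((Kerr.radius a x ^ 2 + a ^ 2) * sinSq a x)) +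
          sigmaCoeff a Λ x * σ ^ 2 -
          delta M a Λ (Kerr.radius a x) * a ^ 2 /
              (xi a Λ ^ 2 * rhoSq a x * (Kerr.radius a x ^ 2 + a ^ 2) ^ 2) * σ ^ 2 +
          2 * tilt M a Λ (Kerr.radius a x) * a / (xi a Λ * (Kerr.radius a x ^ 2 + a ^ 2)) * (σ * d) +
          rhoSq a x * radialCoeff M a Λ (Kerr.radius a x) * d ^ 2 =
        ((deltaTheta a Λ x)⁻¹ * rhoSq a x / (Kerr.radius a x ^ 2 * sinSq a x)) * E ^ 2 +
          (rhoSq a x * radialCoeff M a Λ (Kerr.radius a x)) * (d + (tilt M a Λ (Kerr.radius a x) * a / (xi a Λ * (Kerr.radius a x ^ 2 + a ^ 2))) / (rhoSq a x * radialCoeff M a Λ (Kerr.radius a x)) * σ) ^ 2 +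
          (((deltaTheta a Λ x)⁻¹ / ((Kerr.radius a x ^ 2 + a ^ 2) * sinSq a x) + sigmaCoeff a Λ x - delta M a Λ (Kerr.radius a x) * a ^ 2 / (xi a Λ ^ 2 * rhoSq a x * (Kerr.radius a x ^ 2 + a ^ 2) ^ 2)) - (tilt M a Λ (Kerr.radius a x) * a / (xi a Λ * (Kerr.radius a x ^ 2 + a ^ 2))) ^ 2 / (rhoSq a x * radialCoeff M a Λ (Kerr.radius a x))) * σ ^ 2 := by
      field_simp
      ring
    rw [hsq]
    -- the determinant: `(A11 A22 − A12²)·(Ξ² sin²θ (r²+a²)²) = q̂Δ_θ(r²+a²)² − a² sin²θ (q̂Δ_r + f²)`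
    have hdet : (((deltaTheta a Λ x)⁻¹ / ((Kerr.radius a x ^ 2 + a ^ 2) * sinSq a x) + sigmaCoeff a Λ x - delta M a Λ (Kerr.radius a x) * a ^ 2 / (xi a Λ ^ 2 * rhoSq a x * (Kerr.radius a x ^ 2 + a ^ 2) ^ 2)) * (rhoSq a x * radialCoeff M a Λ (Kerr.radius a x)) - (tilt M a Λ (Kerr.radius a x) * a / (xi a Λ * (Kerr.radius a x ^ 2 + a ^ 2))) ^ 2) * (xi a Λ ^ 2 * sinSq a x * (Kerr.radius a x ^ 2 + a ^ 2) ^ 2) =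
        radialCoeff M a Λ (Kerr.radius a x) * deltaTheta a Λ x * (Kerr.radius a x ^ 2 + a ^ 2) ^ 2 -
          a ^ 2 * sinSq a x *
            (radialCoeff M a Λ (Kerr.radius a x) * delta M a Λ (Kerr.radius a x) + tilt M a Λ (Kerr.radius a x) ^ 2) := by
      have eΔθ : deltaTheta a Λ x = 1 + Λ / 3 * a ^ 2 * (1 - sinSq a x) := by
        unfold deltaTheta sinSq; ring
      have eρ : rhoSq a x = Kerr.radius a x ^ 2 + a ^ 2 * (1 - sinSq a x) := by
        unfold rhoSq sinSq; ring
      have h1 : 1 + Λ / 3 * a ^ 2 * (1 - sinSq a x) ≠ 0 := by rw [← eΔθ]; exact hΔθ'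
      have h2 : Kerr.radius a x ^ 2 + a ^ 2 * (1 - sinSq a x) ≠ 0 := by rw [← eρ]; exact hρ'
      have hs' : sinSq a x ≠ 0 := hs.ne'
      unfold sigmaCoeff
      rw [eΔθ, eρ]
      unfold xi at *
      set l := Λ / 3 with hl
      field_simp
      ring
    have hnum : 0 < radialCoeff M a Λ (Kerr.radius a x) * deltaTheta a Λ x * (Kerr.radius a x ^ 2 + a ^ 2) ^ 2 -
        a ^ 2 * sinSq a x *
          (radialCoeff M a Λ (Kerr.radius a x) * delta M a Λ (Kerr.radius a x) + tilt M a Λ (Kerr.radius a x) ^ 2) := by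
      have hrel' : radialCoeff M a Λ (Kerr.radius a x) * delta M a Λ (Kerr.radius a x) + tilt M a Λ (Kerr.radius a x) ^ 2 = 1 := by
        linarith
      rw [hrel', mul_one]
      -- `q̂ Δθ (r²+a²)² ≥ q̂ (r²+a²)² = Q/Ξ² > a² ≥ a² sin²θ`
      have h0 : 0 ≤ radialCoeff M a Λ (Kerr.radius a x) * (Kerr.radius a x ^ 2 + a ^ 2) ^ 2 := by positivity
      have h1 : radialCoeff M a Λ (Kerr.radius a x) * (Kerr.radius a x ^ 2 + a ^ 2) ^ 2 ≤
          radialCoeff M a Λ (Kerr.radius a x) * deltaTheta a Λ x * (Kerr.radius a x ^ 2 + a ^ 2) ^ 2 :=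
        calc radialCoeff M a Λ (Kerr.radius a x) * (Kerr.radius a x ^ 2 + a ^ 2) ^ 2
            = radialCoeff M a Λ (Kerr.radius a x) * (Kerr.radius a x ^ 2 + a ^ 2) ^ 2 * 1 := by ring
          _ ≤ radialCoeff M a Λ (Kerr.radius a x) * (Kerr.radius a x ^ 2 + a ^ 2) ^ 2 * deltaTheta a Λ x :=
            mul_le_mul_of_nonneg_left hΔθ1 h0
          _ = _ := by ring
      have h2 : xi a Λ ^ 2 * a ^ 2 < xi a Λ ^ 2 * (radialCoeff M a Λ (Kerr.radius a x) * (Kerr.radius a x ^ 2 + a ^ 2) ^ 2) :=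
        calc xi a Λ ^ 2 * a ^ 2 < lapseFn M a Λ (Kerr.radius a x) := hQ
          _ = _ := by rw [← hqQ]; ring
      have h3 : a ^ 2 < radialCoeff M a Λ (Kerr.radius a x) * (Kerr.radius a x ^ 2 + a ^ 2) ^ 2 :=
        lt_of_mul_lt_mul_left h2 (by positivity)
      have h4 : a ^ 2 * sinSq a x ≤ a ^ 2 := mul_le_of_le_one_right (sq_nonneg a) hs1
      linarith
    have hA22pos : 0 < (rhoSq a x * radialCoeff M a Λ (Kerr.radius a x)) := by positivity
    have hdetpos : 0 < ((deltaTheta a Λ x)⁻¹ / ((Kerr.radius a x ^ 2 + a ^ 2) * sinSq a x) + sigmaCoeff a Λ x - delta M a Λ (Kerr.radius a x) * a ^ 2 / (xi a Λ ^ 2 * rhoSq a x * (Kerr.radius a x ^ 2 + a ^ 2) ^ 2)) * (rhoSq a x * radialCoeff M a Λ (Kerr.radius a x)) - (tilt M a Λ (Kerr.radius a x) * a / (xi a Λ * (Kerr.radius a x ^ 2 + a ^ 2))) ^ 2 := by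
      have hc : 0 < xi a Λ ^ 2 * sinSq a x * (Kerr.radius a x ^ 2 + a ^ 2) ^ 2 := by positivity
      by_contra hle
      have hle' := mul_nonpos_of_nonpos_of_nonneg (le_of_not_gt hle) hc.le
      rw [hdet] at hle'
      linarith
    have hP1 : 0 < ((deltaTheta a Λ x)⁻¹ * rhoSq a x / (Kerr.radius a x ^ 2 * sinSq a x)) := by positivity
    have hP3 : 0 < ((deltaTheta a Λ x)⁻¹ / ((Kerr.radius a x ^ 2 + a ^ 2) * sinSq a x) + sigmaCoeff a Λ x - delta M a Λ (Kerr.radius a x) * a ^ 2 / (xi a Λ ^ 2 * rhoSq a x * (Kerr.radius a x ^ 2 + a ^ 2) ^ 2)) - (tilt M a Λ (Kerr.radius a x) * a / (xi a Λ * (Kerr.radius a x ^ 2 + a ^ 2))) ^ 2 / (rhoSq a x * radialCoeff M a Λ (Kerr.radius a x)) := by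
      have heq : ((deltaTheta a Λ x)⁻¹ / ((Kerr.radius a x ^ 2 + a ^ 2) * sinSq a x) + sigmaCoeff a Λ x - delta M a Λ (Kerr.radius a x) * a ^ 2 / (xi a Λ ^ 2 * rhoSq a x * (Kerr.radius a x ^ 2 + a ^ 2) ^ 2)) - (tilt M a Λ (Kerr.radius a x) * a / (xi a Λ * (Kerr.radius a x ^ 2 + a ^ 2))) ^ 2 / (rhoSq a x * radialCoeff M a Λ (Kerr.radius a x)) = (((deltaTheta a Λ x)⁻¹ / ((Kerr.radius a x ^ 2 + a ^ 2) * sinSq a x) + sigmaCoeff a Λ x - delta M a Λ (Kerr.radius a x) * a ^ 2 / (xi a Λ ^ 2 * rhoSq a x * (Kerr.radius a x ^ 2 + a ^ 2) ^ 2)) * (rhoSq a x * radialCoeff M a Λ (Kerr.radius a x)) - (tilt M a Λ (Kerr.radius a x) * a / (xi a Λ * (Kerr.radius a x ^ 2 + a ^ 2))) ^ 2) / (rhoSq a x * radialCoeff M a Λ (Kerr.radius a x)) := by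
        field_simp
      rw [heq]
      positivity
    -- strictness: not all of `σ`, `d`, `E` vanish
    by_cases hσ0 : σ = 0
    · by_cases hd0 : d = 0
      · -- `σ = d = 0` off the axis forces `w 1 = w 2 = 0`, hence `w 3 ≠ 0` and `E = −w 3 ≠ 0`
        have hw3 : w 3 ≠ 0 := by
          intro hw3
          have e1 : x 1 * w 2 - x 2 * w 1 = 0 := by rw [← E4.sigma_apply, ← hσ]; exact hσ0
          have e2 : x 1 * w 1 + x 2 * w 2 = 0 := by
            have hd' := hd0
            rw [hd, drCovector_apply, hw3, mul_zero, add_zero] at hd'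
            have h' : Kerr.radius a x / rhoSq a x * (x 1 * w 1 + x 2 * w 2) = 0 := by
              rw [← hd']; ring
            rcases mul_eq_zero.1 h' with h'' | h''
            · exact absurd h'' (div_pos hr0 hρ).ne'
            · exact h''
          have hw1 : w 1 = 0 := by
            have hh : (x 1 ^ 2 + x 2 ^ 2) * w 1 = 0 := by linear_combination (x 1) * e2 - (x 2) * e1
            exact (mul_eq_zero.1 hh).resolve_left hax
          have hw2 : w 2 = 0 := by
            have hh : (x 1 ^ 2 + x 2 ^ 2) * w 2 = 0 := by linear_combination (x 2) * e2 + (x 1) * e1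
            exact (mul_eq_zero.1 hh).resolve_left hax
          exact hw123.elim (fun h1 ↦ h1 hw1) (fun h23 ↦ h23.elim (fun h2 ↦ h2 hw2) (fun h3 ↦ h3 hw3))
        have hE0 : E ≠ 0 := by rw [hE, hd0, mul_zero, zero_sub]; exact neg_ne_zero.2 hw3
        have hpos1 : 0 < ((deltaTheta a Λ x)⁻¹ * rhoSq a x / (Kerr.radius a x ^ 2 * sinSq a x)) * E ^ 2 := mul_pos hP1 (sq_pos_of_ne_zero hE0)
        linarith [mul_nonneg hA22pos.le (sq_nonneg (d + (tilt M a Λ (Kerr.radius a x) * a / (xi a Λ * (Kerr.radius a x ^ 2 + a ^ 2))) / (rhoSq a x * radialCoeff M a Λ (Kerr.radius a x)) * σ)),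
          mul_nonneg hP3.le (sq_nonneg σ)]
      · have hY : d + (tilt M a Λ (Kerr.radius a x) * a / (xi a Λ * (Kerr.radius a x ^ 2 + a ^ 2))) / (rhoSq a x * radialCoeff M a Λ (Kerr.radius a x)) * σ ≠ 0 := by rw [hσ0, mul_zero, add_zero]; exact hd0
        have hpos2 : 0 < (rhoSq a x * radialCoeff M a Λ (Kerr.radius a x)) * (d + (tilt M a Λ (Kerr.radius a x) * a / (xi a Λ * (Kerr.radius a x ^ 2 + a ^ 2))) / (rhoSq a x * radialCoeff M a Λ (Kerr.radius a x)) * σ) ^ 2 := mul_pos hA22pos (sq_pos_of_ne_zero hY)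
        linarith [mul_nonneg hP1.le (sq_nonneg E), mul_nonneg hP3.le (sq_nonneg σ)]
    · have hpos3 : 0 < (((deltaTheta a Λ x)⁻¹ / ((Kerr.radius a x ^ 2 + a ^ 2) * sinSq a x) + sigmaCoeff a Λ x - delta M a Λ (Kerr.radius a x) * a ^ 2 / (xi a Λ ^ 2 * rhoSq a x * (Kerr.radius a x ^ 2 + a ^ 2) ^ 2)) - (tilt M a Λ (Kerr.radius a x) * a / (xi a Λ * (Kerr.radius a x ^ 2 + a ^ 2))) ^ 2 / (rhoSq a x * radialCoeff M a Λ (Kerr.radius a x))) * σ ^ 2 := mul_pos hP3 (sq_pos_of_ne_zero hσ0)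
      linarith [mul_nonneg hP1.le (sq_nonneg E),
        mul_nonneg hA22pos.le (sq_nonneg (d + (tilt M a Λ (Kerr.radius a x) * a / (xi a Λ * (Kerr.radius a x ^ 2 + a ^ 2))) / (rhoSq a x * radialCoeff M a Λ (Kerr.radius a x)) * σ))]


/-! ### The discharge -/

/-- **Discharge of the named fact `KerrDeSitter.isLorentzian_bilin`** (`KerrDeSitter.lean`,
field of `KerrDeSitter.Facts`): for regular parameters `g_{M,a,Λ}(x)` is nondegenerate, has the
timelike vector `T = −g♯(dt*)` (`g(T, T) = −T⁰ < 0`) and is positive definite on the orthogonal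
complement of every timelike vector, at every point of `Kerr.region a r₀`. Hintz–Vasy 2018,
Prop. 3.5 (non-degenerate Lorentzian signature of `g_b`, including the poles); O'Neill 1983,
Ch. 5, Lemma 5.26. [cite: HintzVasy2018, Prop. 3.5] -/
theorem isLorentzian_bilin_holds (M a Λ r₀ : ℝ) : isLorentzian_bilin M a Λ r₀ := by
  intro h x hx
  have hr0 : 0 < Kerr.radius a x := Kerr.radius_pos_of_mem_region hx
  have hTw : ∀ w : E4, bilin M a Λ x (timeVector M a Λ x) w = -w 0 :=
    bilin_timeVector_holds M a Λ h.lambda_nonneg x hr0 (h.tiltNormSq_pos hx)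
  have hT : bilin M a Λ x (timeVector M a Λ x) (timeVector M a Λ x) < 0 := by
    rw [hTw]
    exact neg_neg_of_pos (timeVector_apply_zero_pos h hx)
  -- positivity on `T^⊥ = {w | w⁰ = 0}`
  have hperp : ∀ w : E4, bilin M a Λ x (timeVector M a Λ x) w = 0 → w ≠ 0 →
      0 < bilin M a Λ x w w := by
    intro w hw hne
    have hw0 : w 0 = 0 := by rw [hTw] at hw; linarith
    exact bilin_spatial_pos h hx hw0 hne
  refine ⟨fun v hv ↦ ?_, ⟨_, hT⟩, fun v w hvv hvw hw ↦
    pos_of_orthogonal_of_pos_on_orthogonal (bilin M a Λ x) (bilin_symm M a Λ x) _ hT hperp v w hvv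
      hvw hw⟩
  -- nondegeneracy: `g(v, ·) = 0` gives `v⁰ = −g(T, v) = 0`, then `g(v, v) = 0` gives `v = 0`
  by_contra hne
  have hv0 : v 0 = 0 := by
    have h1 := hv (timeVector M a Λ x)
    rw [bilin_symm, hTw] at h1
    linarith
  have hpos := bilin_spatial_pos h hx hv0 hne
  rw [hv v] at hpos
  exact lt_irrefl _ hpos

end KerrDeSitter

end Literature.Geometry.Lorentzian

end
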